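import Mathlib
import HarnessLib
import Literature.NumberTheory.Sieve.BatemanHorn

/-!
# The wide far moment S1′ (`stub_farMomentWide`) from Poisson local laws along the system

Line `buchstab-flow-hyperbolicity` of crux stmt-Parity-11291
(`Summit.Parity.BatemanHorn.Theses.AlmostPrimeZeros.SystemZeroRepulsion`), stub S1′
`stub_farMomentWide` (shared verbatim with the lines smooth-rough-lattice-acquisition and
euler-species-factorisation): for a Bateman–Horn system `f` and the capped statistic
`s_f(n) = Σ_i Σ_{p^v ∥ f_i(n)⁺} min(v, 2)`,
`Σ_{n ≤ x} t^{s_f(n)} ≤ (x+1)·exp(C(t·log log x + t²/log log x))` for `x ≥ 3`, `1 ≤ t ≤ √log x`.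

Status.  THEOREM for `k ≤ 1`, `deg ≤ 1`
(`…SmoothRoughLatticeAcquisition.stub_farMomentWide_linear`).  For `Σ deg f_i ≥ 2` it is OPEN and
OUTSIDE PRINT: every printed Nair–Tenenbaum-type bound — Nair–Tenenbaum, Acta Math. 180 (1998) Thm 1;
Henriot, Math. Proc. Camb. Phil. Soc. 152 (2012) Thm 3; Tenenbaum, in *A Tribute to P. Erdős* (1990)
Lemme 3.5; Tenenbaum, J. Number Theory 188 (2018) Thm 1; Goudout, Proc. LMS 115 (2017) — fixes the
tilt `A = t` (resp. the range `k_j ≤ R·log log x`) and, traced, its constant is `exp(A^{O(1)})`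
(resp. `exp(R^{O(1)})`); see the worker's table `work/stubs/FarMomentWide.md`.

This file isolates, kernel-checked and with NO new definition (the hypothesis is an antecedent,
per system), the exact anatomy input that suffices: Poisson ("Hardy–Ramanujan") local laws for the
capped statistic along the system at ALL levels `m`,
`#{n ≤ x : s_f(n) = m} ≤ C (x+1) (C log log x)^m / m!`  (`x ≥ 3`, `m ≥ 0`),
printed for `f = X` (Hardy–Ramanujan 1917) and, for general systems, only for
`m_j ≤ R·log log x` with an `R`-dependent constant (Tenenbaum 2018, Thm 1).  Summing the
exponential series (`Real.sum_le_exp_of_nonneg`) gives S1′, indeed the stronger S1 shape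
`exp(C'·t·log log x)`; the window `t ≤ √log x` is not used.
-/

namespace Summit.Parity.BatemanHorn.Cruxes.SystemZeroRepulsion.BuchstabFlowHyperbolicity

open Finset Real

/-- `0 < log log 3`, i.e. `1 < log 3` (as `e < 3`). -/
private theorem loglog_three_pos : 0 < Real.log (Real.log 3) := by
  refine Real.log_pos ?_
  rw [Real.lt_log_iff_exp_lt (by norm_num)]
  have := Real.exp_one_lt_d9
  linarith

/-- Summing Poisson local laws: if every fibre `{n ∈ S : s n = m}` has at most `K·y^m/m!`
elements (`K, y ≥ 0`), then `Σ_{n ∈ S} t^{s n} ≤ K·exp(y·t)` for every `t ≥ 0`. -/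
private theorem sum_pow_le_of_localLaws {S : Finset ℕ} (s : ℕ → ℕ) {K y t : ℝ} (hK : 0 ≤ K)
    (hy : 0 ≤ y) (ht : 0 ≤ t)
    (h : ∀ m : ℕ, (((S.filter fun n => s n = m).card : ℕ) : ℝ) ≤ K * y ^ m / (m.factorial : ℝ)) :
    ∑ n ∈ S, t ^ (s n) ≤ K * Real.exp (y * t) := by
  classical
  have hterm : ∀ m ∈ S.image s,
      ((S.filter fun n => s n = m).card) • (t ^ m) ≤ K * ((y * t) ^ m / (m.factorial : ℝ)) := by
    intro m _
    rw [nsmul_eq_mul]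
    calc (((S.filter fun n => s n = m).card : ℕ) : ℝ) * t ^ m
        ≤ (K * y ^ m / (m.factorial : ℝ)) * t ^ m :=
          mul_le_mul_of_nonneg_right (h m) (pow_nonneg ht _)
      _ = K * ((y * t) ^ m / (m.factorial : ℝ)) := by rw [mul_pow]; ring
  set N : ℕ := (S.image s).sup id + 1 with hN
  have hsub : S.image s ⊆ Finset.range N := by
    intro m hm
    have hle : m ≤ (S.image s).sup id := Finset.le_sup (f := id) hm
    exact Finset.mem_range.mpr (by omega)
  have hyt : 0 ≤ y * t := mul_nonneg hy ht
  calc ∑ n ∈ S, t ^ (s n)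
      = ∑ m ∈ S.image s, ((S.filter fun n => s n = m).card) • (t ^ m) :=
        Finset.sum_comp (fun m => t ^ m) s
    _ ≤ ∑ m ∈ S.image s, K * ((y * t) ^ m / (m.factorial : ℝ)) := Finset.sum_le_sum hterm
    _ ≤ ∑ m ∈ Finset.range N, K * ((y * t) ^ m / (m.factorial : ℝ)) := by
        refine Finset.sum_le_sum_of_subset_of_nonneg hsub fun m _ _ => ?_
        positivity
    _ = K * ∑ m ∈ Finset.range N, (y * t) ^ m / (m.factorial : ℝ) := by rw [Finset.mul_sum]
    _ ≤ K * Real.exp (y * t) :=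
        mul_le_mul_of_nonneg_left (Real.sum_le_exp_of_nonneg hyt N) hK

/-- **S1′ from Poisson local laws along the system.**  For every Bateman–Horn system `f`
(indeed for every `k, f`): if the capped statistic `s_f` obeys the Hardy–Ramanujan-type local laws
`#{n ≤ x : s_f(n) = m} ≤ C (x+1) (C log log x)^m/m!` for all `x ≥ 3` and ALL `m`, then the wide
far moment S1′ (`stub_farMomentWide`) holds for `f`, with constant `max |C| 1 · (1 + 1/log log 3)`. -/
theorem farMomentWide_of_localLaws :
    ∀ (k : ℕ) (f : Fin k → Polynomial ℤ), Literature.NumberTheory.Sieve.IsBatemanHornSystem f →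
      (∃ C : ℝ, ∀ x : ℕ, 3 ≤ x → ∀ m : ℕ,
        ((((Finset.range (x + 1)).filter fun n : ℕ =>
            (∑ i, (((f i).eval (n : ℤ)).toNat.factorization.sum fun _ v => min v 2)) = m).card : ℕ) : ℝ) ≤
          C * ((x : ℝ) + 1) * (C * Real.log (Real.log (x : ℝ))) ^ m / (m.factorial : ℝ)) →
      ∃ C : ℝ, ∀ x : ℕ, 3 ≤ x → ∀ t : ℝ, 1 ≤ t → t ≤ Real.sqrt (Real.log (x : ℝ)) →
        (∑ n ∈ Finset.range (x + 1), (t : ℝ) ^ (∑ i, (((f i).eval (n : ℤ)).toNat.factorization.sum fun _ v => min v 2))) ≤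
          ((x : ℝ) + 1) * Real.exp (C * (t * Real.log (Real.log (x : ℝ)) + t ^ 2 / Real.log (Real.log (x : ℝ)))) := by
  intro k f _ hLL
  obtain ⟨C, hC⟩ := hLL
  set s : ℕ → ℕ :=
    (fun n : ℕ => ∑ i, (((f i).eval (n : ℤ)).toNat.factorization.sum fun _ v => min v 2)) with hs
  -- a positive version of the constant
  set C' : ℝ := max |C| 1 with hC'
  have hC'1 : 1 ≤ C' := le_max_right _ _
  have hC'0 : 0 ≤ C' := by linarith
  have hCC' : |C| ≤ C' := le_max_left _ _
  set L₀ : ℝ := Real.log (Real.log 3) with hL₀_def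
  have hL₀ : 0 < L₀ := loglog_three_pos
  refine ⟨C' * (1 + 1 / L₀), fun x hx t ht _ => ?_⟩
  set L : ℝ := Real.log (Real.log (x : ℝ)) with hL
  have hx3 : (3 : ℝ) ≤ x := by exact_mod_cast hx
  have hLL₀ : L₀ ≤ L :=
    Real.log_le_log (Real.log_pos (by norm_num)) (Real.log_le_log (by norm_num) hx3)
  have hL0 : 0 ≤ L := hL₀.le.trans hLL₀
  have ht0 : 0 ≤ t := by linarith
  have hx0 : (0 : ℝ) ≤ (x : ℝ) + 1 := by positivity
  -- the local laws with the positive constant `C'`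
  have hC'm : ∀ m : ℕ,
      ((((Finset.range (x + 1)).filter fun n => s n = m).card : ℕ) : ℝ) ≤
        (C' * ((x : ℝ) + 1)) * (C' * L) ^ m / (m.factorial : ℝ) := by
    intro m
    have h1 := hC x hx m
    have h2 : (|C| * L) ^ m ≤ (C' * L) ^ m :=
      pow_le_pow_left₀ (by positivity) (mul_le_mul_of_nonneg_right hCC' hL0) m
    have h3 : |C| * ((x : ℝ) + 1) ≤ C' * ((x : ℝ) + 1) := mul_le_mul_of_nonneg_right hCC' hx0
    have h4 : |C| * ((x : ℝ) + 1) * (|C| * L) ^ m ≤ C' * ((x : ℝ) + 1) * (C' * L) ^ m :=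
      mul_le_mul h3 h2 (by positivity) (by positivity)
    calc ((((Finset.range (x + 1)).filter fun n => s n = m).card : ℕ) : ℝ)
        ≤ C * ((x : ℝ) + 1) * (C * L) ^ m / (m.factorial : ℝ) := h1
      _ ≤ |C * ((x : ℝ) + 1) * (C * L) ^ m / (m.factorial : ℝ)| := le_abs_self _
      _ = |C| * ((x : ℝ) + 1) * (|C| * L) ^ m / (m.factorial : ℝ) := by
          rw [abs_div, abs_mul, abs_mul, abs_pow, abs_mul, abs_of_nonneg hx0, abs_of_nonneg hL0,
            Nat.abs_cast]
      _ ≤ C' * ((x : ℝ) + 1) * (C' * L) ^ m / (m.factorial : ℝ) :=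
          div_le_div_of_nonneg_right h4 (by positivity)
  -- sum the exponential series
  have hsum : ∑ n ∈ Finset.range (x + 1), t ^ (s n) ≤ C' * ((x : ℝ) + 1) * Real.exp (C' * L * t) :=
    sum_pow_le_of_localLaws s (by positivity) (by positivity) ht0 hC'm
  -- absorb the constant `C'` into the exponent: `C' ≤ exp C' ≤ exp (C' t L / L₀)`
  have htL : L₀ ≤ t * L := by nlinarith
  have hkey : C' ≤ C' * (t * L) / L₀ := by
    rw [le_div_iff₀ hL₀]
    exact mul_le_mul_of_nonneg_left htL hC'0
  have hexpC : C' ≤ Real.exp C' := by linarith [Real.add_one_le_exp C']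
  have hfin : C' * ((x : ℝ) + 1) * Real.exp (C' * L * t) ≤
      ((x : ℝ) + 1) * Real.exp (C' * (1 + 1 / L₀) * (t * L + t ^ 2 / L)) := by
    have e1 : C' * Real.exp (C' * L * t) ≤ Real.exp (C' * (1 + 1 / L₀) * (t * L + t ^ 2 / L)) := by
      calc C' * Real.exp (C' * L * t) ≤ Real.exp C' * Real.exp (C' * L * t) :=
            mul_le_mul_of_nonneg_right hexpC (Real.exp_pos _).le
        _ = Real.exp (C' + C' * L * t) := (Real.exp_add _ _).symm
        _ ≤ Real.exp (C' * (t * L) / L₀ + C' * L * t) := Real.exp_le_exp.mpr (by linarith)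
        _ = Real.exp (C' * (1 + 1 / L₀) * (t * L)) := by congr 1; field_simp; ring
        _ ≤ Real.exp (C' * (1 + 1 / L₀) * (t * L + t ^ 2 / L)) := by
            refine Real.exp_le_exp.mpr (mul_le_mul_of_nonneg_left ?_ (by positivity))
            have : 0 ≤ t ^ 2 / L := div_nonneg (sq_nonneg t) hL0
            linarith
    calc C' * ((x : ℝ) + 1) * Real.exp (C' * L * t) = ((x : ℝ) + 1) * (C' * Real.exp (C' * L * t)) := by
          ring
      _ ≤ ((x : ℝ) + 1) * Real.exp (C' * (1 + 1 / L₀) * (t * L + t ^ 2 / L)) :=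
          mul_le_mul_of_nonneg_left e1 hx0
  exact hsum.trans hfin

end Summit.Parity.BatemanHorn.Cruxes.SystemZeroRepulsion.BuchstabFlowHyperbolicity
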